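import Mathlib.RepresentationTheory.Basic
import Mathlib.LinearAlgebra.Quotient.Basic
import HarnessLib

/-!
# The maximal quotient of a representation on which a central subgroup acts through a character

Kernel construction (no citation content): for a `k`-linear representation `ρ` of a group `G`, a
homomorphism `ζ : Z →* G` into the centre and a character `χ : Z →* kˣ`, the **`χ`-augmentation
submodule** `augmentation ρ ζ χ = Σ_z range (ρ(ζ z) − χ(z)·id)` is `G`-stable, and the quotient
`V ⧸ augmentation ρ ζ χ` carries the representation `quotRep ρ ζ χ hζ` — the MAXIMAL quotient of
`ρ` on which `Z` acts through `χ` (universal property `liftQ_of`).  This is the module operation of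
[Liu 2021, App. B §B.1, Step 3] ("the maximal quotient … with central character `χ`"), written
generically so that an instance of the record datum
`Literature.RepresentationTheory.Liu2021.LocalOscillatorDatum` can be assembled from
`(ρ, ζ, χ)` alone (fields `quot := quotRep …`, `proj := mkQ`, `ker_proj := ker_mkQ …`).
-/

namespace Literature.RepresentationTheory.CentralCharacterQuotient

universe uk uG uZ uV

variable {k : Type uk} {G : Type uG} {Z : Type uZ} {V : Type uV} [CommRing k] [Group G] [Group Z]
  [AddCommGroup V] [Module k V]

/-- The `χ`-augmentation submodule `Σ_{z} range (ρ(ζ z) − χ(z) • id)`: the span of the vectors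
`ρ(ζ z) v − χ(z) v`. [folklore] -/
def augmentation (ρ : Representation k G V) (ζ : Z →* G) (χ : Z →* kˣ) : Submodule k V :=
  ⨆ z : Z, LinearMap.range (ρ (ζ z) - (χ z : k) • LinearMap.id)

/-- The generators `ρ(ζ z) v − χ(z) v` lie in the augmentation submodule. [folklore] -/
theorem sub_smul_mem_augmentation (ρ : Representation k G V) (ζ : Z →* G) (χ : Z →* kˣ) (z : Z)
    (v : V) : ρ (ζ z) v - (χ z : k) • v ∈ augmentation ρ ζ χ :=
  Submodule.mem_iSup_of_mem z ⟨v, rfl⟩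

/-- `ρ g` commutes with `ρ (ζ z)` when `ζ z` is central. [folklore] -/
theorem apply_zeta_comm (ρ : Representation k G V) {ζ : Z →* G}
    (hζ : ∀ z, ζ z ∈ Subgroup.center G) (g : G) (z : Z) (v : V) :
    ρ g (ρ (ζ z) v) = ρ (ζ z) (ρ g v) := by
  have h : g * ζ z = ζ z * g := (Subgroup.mem_center_iff.mp (hζ z) g)
  rw [← Module.End.mul_apply, ← map_mul, h, map_mul, Module.End.mul_apply]

/-- The augmentation submodule is `G`-stable when `ζ` is central. [folklore] -/
theorem augmentation_le_comap (ρ : Representation k G V) {ζ : Z →* G}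
    (hζ : ∀ z, ζ z ∈ Subgroup.center G) (χ : Z →* kˣ) (g : G) :
    augmentation ρ ζ χ ≤ (augmentation ρ ζ χ).comap (ρ g) := by
  refine iSup_le fun z => ?_
  rintro _ ⟨v, rfl⟩
  simp only [Submodule.mem_comap, LinearMap.sub_apply, LinearMap.smul_apply, LinearMap.id_coe,
    id_eq, map_sub, map_smul, apply_zeta_comm ρ hζ g z v]
  exact sub_smul_mem_augmentation ρ ζ χ z (ρ g v)

/-- **The maximal `χ`-quotient** `V ⧸ augmentation ρ ζ χ` with its `G`-action. [folklore] -/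
def quotRep (ρ : Representation k G V) {ζ : Z →* G} (hζ : ∀ z, ζ z ∈ Subgroup.center G)
    (χ : Z →* kˣ) : Representation k G (V ⧸ augmentation ρ ζ χ) :=
  ρ.quotient (augmentation ρ ζ χ) (augmentation_le_comap ρ hζ χ)

/-- The quotient map intertwines: `quotRep g (mk v) = mk (ρ g v)`. [folklore] -/
@[simp] theorem quotRep_mk (ρ : Representation k G V) {ζ : Z →* G}
    (hζ : ∀ z, ζ z ∈ Subgroup.center G) (χ : Z →* kˣ) (g : G) (v : V) :
    quotRep ρ hζ χ g (Submodule.Quotient.mk v) =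
      (Submodule.Quotient.mk (ρ g v) : V ⧸ augmentation ρ ζ χ) :=
  rfl

/-- Equivariance of the quotient map `mkQ`, pointwise. [folklore] -/
theorem mkQ_apply_comm (ρ : Representation k G V) {ζ : Z →* G}
    (hζ : ∀ z, ζ z ∈ Subgroup.center G) (χ : Z →* kˣ) (g : G) (v : V) :
    (augmentation ρ ζ χ).mkQ (ρ g v) = quotRep ρ hζ χ g ((augmentation ρ ζ χ).mkQ v) :=
  rfl

/-- The quotient map is surjective. [folklore] -/
theorem mkQ_surjective (ρ : Representation k G V) (ζ : Z →* G) (χ : Z →* kˣ) :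
    Function.Surjective (augmentation ρ ζ χ).mkQ :=
  Submodule.mkQ_surjective _

/-- The kernel of the quotient map is the augmentation submodule (the MAXIMALITY field of the
Liu datum). [folklore] -/
theorem ker_mkQ (ρ : Representation k G V) (ζ : Z →* G) (χ : Z →* kˣ) :
    LinearMap.ker (augmentation ρ ζ χ).mkQ =
      ⨆ z : Z, LinearMap.range (ρ (ζ z) - (χ z : k) • LinearMap.id) :=
  Submodule.ker_mkQ _

/-- On the quotient, `Z` acts through `χ`. [folklore] -/
theorem quotRep_zeta (ρ : Representation k G V) {ζ : Z →* G}
    (hζ : ∀ z, ζ z ∈ Subgroup.center G) (χ : Z →* kˣ) (z : Z)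
    (w : V ⧸ augmentation ρ ζ χ) : quotRep ρ hζ χ (ζ z) w = (χ z : k) • w := by
  obtain ⟨v, rfl⟩ := Submodule.mkQ_surjective _ w
  rw [Submodule.mkQ_apply, quotRep_mk, ← sub_eq_zero, ← Submodule.Quotient.mk_smul,
    ← Submodule.Quotient.mk_sub, Submodule.Quotient.mk_eq_zero]
  exact sub_smul_mem_augmentation ρ ζ χ z v

/-- UNIVERSAL PROPERTY: a linear map on which the generators die factors through the maximal
`χ`-quotient. [folklore] -/
theorem augmentation_le_ker {U : Type*} [AddCommGroup U] [Module k U] (ρ : Representation k G V)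
    (ζ : Z →* G) (χ : Z →* kˣ) (f : V →ₗ[k] U)
    (hf : ∀ z v, f (ρ (ζ z) v) = (χ z : k) • f v) : augmentation ρ ζ χ ≤ LinearMap.ker f := by
  refine iSup_le fun z => ?_
  rintro _ ⟨v, rfl⟩
  simp [LinearMap.mem_ker, hf]

/-- The factorisation `f = (liftQ f) ∘ mkQ` through the maximal `χ`-quotient. [folklore] -/
theorem liftQ_mkQ {U : Type*} [AddCommGroup U] [Module k U] (ρ : Representation k G V)
    (ζ : Z →* G) (χ : Z →* kˣ) (f : V →ₗ[k] U)
    (hf : ∀ z v, f (ρ (ζ z) v) = (χ z : k) • f v) (v : V) :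
    (augmentation ρ ζ χ).liftQ f (augmentation_le_ker ρ ζ χ f hf) ((augmentation ρ ζ χ).mkQ v) =
      f v :=
  rfl

end Literature.RepresentationTheory.CentralCharacterQuotient
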